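import Literature.NumberTheory.DiophantineGeometry.TateAlgorithmMordellCharTwoProofs
import Literature.NumberTheory.EllipticCurves.QuadraticTwist
import HarnessLib

/-!
# Quadratic twists of an elliptic curve with good reduction, `2` a uniformiser: Tate's algorithm
# on explicit models (Kodaira types `I₄*`, `I₈*`, `II*`, `II`)

`Proofs` file (theorems only, no definitions, no named facts) in topic
`NumberTheory/EllipticCurves`, companion of `QuadraticTwistLocalDataAtTwo`
(the named fact `Literature.NumberTheory.EllipticCurves.BarriosEtAl2025_quadraticTwist_two_of_goodReduction`,
Barrios–Roy–Sahajpal–Tallana–Tobin–Wiersema, Res. Number Theory 11 (2025), Thm. 5.1, rows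
`R = I₀`) and of `QuadraticTwistTateFormTwoProofs` (the same computation for the Tate normal form
at the place `2` of `ℚ`, potentially multiplicative / good ordinary case).

Let `R` be a discrete valuation ring with perfect residue field in which `2 = ϖ ε` is a
uniformiser times a unit (e.g. `R = ℤ₂`), and let `V` be a Weierstrass equation over `R` with
**unit discriminant** (good reduction).  For an odd integer parameter the twisting parameter
`d ∈ ℤ` is read in `R`; `d ≡ 3 (mod 4)` and `d ≡ 2 (mod 4)` are the two ramified square classes of
the paper's tables (`v(d) = 0, d ≡ 3 (4)` and `v(d) = 1`).  We run Silverman's Tate algorithm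
(*ATAEC* IV.9.4), as implemented literally by `WeierstrassCurve.kodairaSymbolOfMinimal`, on
explicit `R`-models of the quadratic twist `V^{(d)}` (`WeierstrassCurve.quadraticTwist`,
`y² = x³ + (d b₂/4) x² + (d² b₄/2) x + d³ b₆/4`, rescaled by `u = 1/2`):

* **`a₁` a unit** (ordinary good reduction).  `V` is `R`-isomorphic to `⟨1, a₂, 0, a₄, a₆⟩`
  with `4 ∣ a₄` and `a₆` a unit (`exists_smul_ordinaryNormalForm`).  For such `V`:
  `d ≡ 3 (4)`: `M = ⟨2, d(1 + 4a₂) - 1, 0, 16d²a₄, 64d³a₆⟩` is family A of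
  `TateAlgorithmIstarCharTwoProofs` with `N = 6`: **type `I₄*`**, `ord Δ(M) = 12`
  (`kodairaSymbolOfMinimal_twistGoodOrdinary_three`); `d ≡ 2 (4)`:
  `T = ⟨0, d(1 + 4a₂), 0, 16d²a₄, 64d³a₆⟩` is family B with `N = 9`: **type `I₈*`**,
  `ord Δ(T) = 18` (`kodairaSymbolOfMinimal_twistGoodOrdinary_two`).
* **`a₁ ∈ 𝔪`** (supersingular good reduction).  `V` is `R`-isomorphic to `⟨0, a₂, a₃, a₄, a₆⟩`
  with `a₃` a unit (`exists_smul_a₁_eq_zero`, `isUnit_a₃_of_a₁_eq_zero`); the types `II*`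
  (`d ≡ 3 (4)`) and `II` (`d ≡ 2 (4)`) of its twists, and the explicit changes of variables
  relating all four models to `(V ⊗ K).quadraticTwist d`, are in the sequel
  `QuadraticTwistGoodReductionCharTwoSupersingularProofs`.

These are exactly the Kodaira types of the rows `R = I₀` of the `ℚ₂` tables of Barrios et al.
(I₄*/II* for `v(d) = 0`, `d ≡ 3 (4)`; I₈*/II for `v(d) = 1`), obtained by running Silverman's
algorithm; the minimality of the models and the Tamagawa numbers are read off afterwards
(`TateAlgorithmExitMinimalityProofs`, `NeronComponentIndex*Proofs`).

## References

* A. J. Barrios, M. Roy, N. Sahajpal, D. Tallana, B. Tobin, H. Wiersema, *Local data of elliptic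
  curves under quadratic twist*, Res. Number Theory 11 (2025), Thm. 5.1, §5 tables, rows `I₀`
  (arXiv:2501.03209 pp. 15–16), §5.1 Case 1, §5.2 Case 1. [BarriosEtAl2025]
* J. H. Silverman, *Advanced Topics in the Arithmetic of Elliptic Curves*, GTM 151 (1994), IV.9.4
  (Tate's algorithm) and Table 4.1. [SilvermanATAEC1994]
* J. H. Silverman, *The Arithmetic of Elliptic Curves*, 2nd ed. (2009), III.1 Table 3.1,
  X.5 Cor. 5.4 (quadratic twists). [SilvermanAEC2009]
-/

noncomputable section

open IsLocalRing
open IsDiscreteValuationRing hiding maximalIdeal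

namespace Literature.NumberTheory.EllipticCurves

namespace TwistGoodTwo

open Literature.NumberTheory.DiophantineGeometry Literature.NumberTheory.DiophantineGeometry.TateAlgorithm

variable {R : Type*} [CommRing R] [IsDomain R] [IsDiscreteValuationRing R]

/-! ### Arithmetic helpers: `2 = ϖ ε` -/

/-- With `2 = ϖ ε`: `2 ^ n = ϖ ^ n ε ^ n`. [folklore] -/
private theorem two_pow_eq {ε : R} (hε : (2 : R) = uniformizer R * ε) (n : ℕ) :
    (2 : R) ^ n = uniformizer R ^ n * ε ^ n := by
  rw [hε, mul_pow]

/-- An odd integer is a unit of `R` when `2 = ϖ ε` (it is `1 + ϖ(⋯)`). [folklore] -/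
private theorem isUnit_intCast_of_odd {ε : R} (hε : (2 : R) = uniformizer R * ε) {n : ℤ} (hn : Odd n) :
    IsUnit (n : R) := by
  obtain ⟨k, rfl⟩ := hn
  have e : ((2 * k + 1 : ℤ) : R) = 1 + uniformizer R * (ε * k) := by
    push_cast; rw [hε]; ring
  rw [e]
  exact isUnit_one_add_uniformizer_mul _

/-! ### Discriminant identities -/

omit [IsDomain R] [IsDiscreteValuationRing R] in
/-- For `a₁ = 1`, `a₃ = 0`: `Δ + a₆ = 2 P + a₄ Q` explicitly (so `Δ ≡ a₆ + a₄²`, and `Δ ≡ a₆`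
modulo `(2, a₄)`). Silverman *AEC* III.1. [folklore] -/
private theorem Δ_add_a₆_of_a₁_eq_one (V : WeierstrassCurve R) (h1 : V.a₁ = 1) (h3 : V.a₃ = 0) :
    V.Δ + V.a₆ = 2 * (-(2 * V.a₂ * (3 + 12 * V.a₂ + 16 * V.a₂ ^ 2) * V.a₆) - 32 * V.a₄ ^ 3
      - 216 * V.a₆ ^ 2 + 36 * (1 + 4 * V.a₂) * V.a₄ * V.a₆) + V.a₄ * ((1 + 4 * V.a₂) ^ 2 * V.a₄) := by
  simp only [WeierstrassCurve.Δ, WeierstrassCurve.b₂, WeierstrassCurve.b₄, WeierstrassCurve.b₆,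
    WeierstrassCurve.b₈, h1, h3]
  ring

omit [IsDomain R] [IsDiscreteValuationRing R] in
/-- For `a₁ = 0`: `Δ + 27 a₃⁴ = 2 P` explicitly (so `Δ ≡ a₃⁴` modulo `2`). Silverman *AEC* III.1.
[folklore] -/
private theorem Δ_add_of_a₁_eq_zero (V : WeierstrassCurve R) (h1 : V.a₁ = 0) :
    V.Δ + 27 * V.a₃ ^ 4 = 2 * (-(8 * V.a₂ ^ 2 * (4 * V.a₂ * V.a₆ + V.a₂ * V.a₃ ^ 2 - V.a₄ ^ 2))
      - 32 * V.a₄ ^ 3 - 108 * V.a₃ ^ 2 * V.a₆ - 216 * V.a₆ ^ 2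
      + 36 * V.a₂ * V.a₄ * (V.a₃ ^ 2 + 4 * V.a₆)) := by
  simp only [WeierstrassCurve.Δ, WeierstrassCurve.b₂, WeierstrassCurve.b₄, WeierstrassCurve.b₆,
    WeierstrassCurve.b₈, h1]
  ring

/-- For `a₁ = 1`, `a₃ = 0`, `2 ∣ a₄` and `Δ` a unit: `a₆` is a unit (`2 = ϖ ε`), from
`Δ = -b₂²b₈ - 8b₄³ - 27b₆² + 9b₂b₄b₆ ≡ a₆ + a₄²` modulo `2`. Silverman *AEC* III.1.
[cite: SilvermanAEC2009, III.1 (formulas for b₂, b₄, b₆, b₈, Δ)] -/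
theorem isUnit_a₆_of_a₁_eq_one {ε : R} (hε : (2 : R) = uniformizer R * ε) (V : WeierstrassCurve R)
    (h1 : V.a₁ = 1) (h3 : V.a₃ = 0) (h4 : (2 : R) ∣ V.a₄) (hΔ : IsUnit V.Δ) : IsUnit V.a₆ := by
  have hϖ : Irreducible (uniformizer R) := irreducible_uniformizer
  have h2 : uniformizer R ∣ (2 : R) := ⟨ε, hε⟩
  rw [isUnit_iff_not_dvd hϖ] at hΔ ⊢
  intro h6
  apply hΔ
  have e := Δ_add_a₆_of_a₁_eq_one V h1 h3
  have : V.Δ = 2 * (-(2 * V.a₂ * (3 + 12 * V.a₂ + 16 * V.a₂ ^ 2) * V.a₆) - 32 * V.a₄ ^ 3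
      - 216 * V.a₆ ^ 2 + 36 * (1 + 4 * V.a₂) * V.a₄ * V.a₆) + V.a₄ * ((1 + 4 * V.a₂) ^ 2 * V.a₄)
      - V.a₆ := by linear_combination e
  rw [this]
  exact dvd_sub (dvd_add (h2.mul_right _) ((h2.trans h4).mul_right _)) h6

/-- For `a₁ = 0` and `Δ` a unit: `a₃` is a unit (`2 = ϖ ε`), from
`Δ = -b₂²b₈ - 8b₄³ - 27b₆² + 9b₂b₄b₆ ≡ -27a₃⁴` modulo `2`. Silverman *AEC* III.1.
[cite: SilvermanAEC2009, III.1 (formulas for b₂, b₄, b₆, b₈, Δ)] -/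
theorem isUnit_a₃_of_a₁_eq_zero {ε : R} (hε : (2 : R) = uniformizer R * ε) (V : WeierstrassCurve R)
    (h1 : V.a₁ = 0) (hΔ : IsUnit V.Δ) : IsUnit V.a₃ := by
  have hϖ : Irreducible (uniformizer R) := irreducible_uniformizer
  have h2 : uniformizer R ∣ (2 : R) := ⟨ε, hε⟩
  rw [isUnit_iff_not_dvd hϖ] at hΔ ⊢
  intro h3
  apply hΔ
  have e := Δ_add_of_a₁_eq_zero V h1
  have : V.Δ = 2 * (-(8 * V.a₂ ^ 2 * (4 * V.a₂ * V.a₆ + V.a₂ * V.a₃ ^ 2 - V.a₄ ^ 2))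
      - 32 * V.a₄ ^ 3 - 108 * V.a₃ ^ 2 * V.a₆ - 216 * V.a₆ ^ 2
      + 36 * V.a₂ * V.a₄ * (V.a₃ ^ 2 + 4 * V.a₆)) - 27 * V.a₃ ^ 4 := by linear_combination e
  rw [this]
  exact dvd_sub (h2.mul_right _) ((dvd_pow h3 four_ne_zero).mul_left _)

/-! ### Normal forms over `R` -/

omit [IsDomain R] [IsDiscreteValuationRing R] in
/-- **Ordinary normal form.**  If `a₁` is a unit, `V` is `R`-isomorphic to an equation with
`a₁ = 1`, `a₃ = 0`, `4 ∣ a₄`: rescale by `u = a₁`, translate `x ↦ x - a₃`, then apply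
`(1; -2a₄, 0, a₄)`, which keeps `a₁ = 1, a₃ = 0` and replaces `a₄` by `4a₄(3a₄ - a₂)`
(transformation formulas of Silverman *AEC* III.1 Table 3.1). [cite: SilvermanAEC2009, III.1 Table 3.1] -/
theorem exists_smul_ordinaryNormalForm (V : WeierstrassCurve R) (ha : IsUnit V.a₁) :
    ∃ D : WeierstrassCurve.VariableChange R,
      (D • V).a₁ = 1 ∧ (D • V).a₃ = 0 ∧ (4 : R) ∣ (D • V).a₄ := by
  set u := ha.unit with hu
  set D₁ : WeierstrassCurve.VariableChange R := ⟨u, 0, 0, 0⟩ with hD₁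
  set V₁ := D₁ • V with hV₁
  have h11 : V₁.a₁ = 1 := by
    rw [hV₁, hD₁, WeierstrassCurve.variableChange_a₁]
    simp [hu]
  set D₂ : WeierstrassCurve.VariableChange R := ⟨1, -V₁.a₃, 0, 0⟩ with hD₂
  set V₂ := D₂ • V₁ with hV₂
  have h21 : V₂.a₁ = 1 := by
    rw [hV₂, hD₂, WeierstrassCurve.variableChange_a₁, h11]; simp
  have h23 : V₂.a₃ = 0 := by
    rw [hV₂, hD₂, WeierstrassCurve.variableChange_a₃, h11]; simp
  set D₃ : WeierstrassCurve.VariableChange R := ⟨1, -(2 * V₂.a₄), 0, V₂.a₄⟩ with hD₃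
  refine ⟨D₃ * D₂ * D₁, ?_, ?_, ?_⟩
  · rw [mul_smul, mul_smul, ← hV₁, ← hV₂, hD₃, WeierstrassCurve.variableChange_a₁, h21]
    simp only [Units.val_one, inv_one, one_mul, mul_zero, add_zero]
  · rw [mul_smul, mul_smul, ← hV₁, ← hV₂, hD₃, WeierstrassCurve.variableChange_a₃, h21, h23]
    simp only [Units.val_one, inv_one, one_pow, one_mul]
    ring
  · rw [mul_smul, mul_smul, ← hV₁, ← hV₂, hD₃, WeierstrassCurve.variableChange_a₄, h21, h23]
    refine ⟨V₂.a₄ * (3 * V₂.a₄ - V₂.a₂), ?_⟩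
    simp only [Units.val_one, inv_one, one_pow, one_mul]
    ring

/-- **Supersingular normal form.**  If `ϖ ∣ a₁` (`2 = ϖ ε`), the change `(1; 0, -a₁/2, 0)` over
`R` kills `a₁` (transformation formula `a₁' = a₁ + 2s`, Silverman *AEC* III.1 Table 3.1).
[cite: SilvermanAEC2009, III.1 Table 3.1] -/
theorem exists_smul_a₁_eq_zero {ε : R} (hε : (2 : R) = uniformizer R * ε) (hεu : IsUnit ε)
    (V : WeierstrassCurve R) (ha : uniformizer R ∣ V.a₁) :
    ∃ D : WeierstrassCurve.VariableChange R, D.u = 1 ∧ (D • V).a₁ = 0 := by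
  obtain ⟨α, hα⟩ := ha
  obtain ⟨e', he'⟩ := hεu.exists_right_inv
  refine ⟨⟨1, 0, -(α * e'), 0⟩, rfl, ?_⟩
  rw [WeierstrassCurve.variableChange_a₁, hα]
  simp only [Units.val_one, inv_one, one_mul]
  have : uniformizer R * α + 2 * -(α * e') = uniformizer R * α * (1 - ε * e') := by
    rw [hε]; ring
  rw [this, he', sub_self, mul_zero]

/-! ### `a₁ = 1, a₃ = 0`: the models of the twist and their Kodaira types `I₄*`, `I₈*` -/

section Ordinary

variable [PerfectField (ResidueField R)] {ε : R} (hε : (2 : R) = uniformizer R * ε)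
  (hεu : IsUnit ε) (V : WeierstrassCurve R) (h1 : V.a₁ = 1) (h3 : V.a₃ = 0)
  (h4 : (4 : R) ∣ V.a₄) (hΔ : IsUnit V.Δ)
include hε hεu h1 h3 h4 hΔ

omit [PerfectField (ResidueField R)] hεu in
/-- In the ordinary normal form (`a₁ = 1, a₃ = 0, 4 ∣ a₄`, `Δ ∈ Rˣ`), `a₆` is a unit. [folklore] -/
private theorem isUnit_a₆_ordinaryNormalForm : IsUnit V.a₆ :=
  isUnit_a₆_of_a₁_eq_one hε V h1 h3
    ((show (2 : R) ∣ 4 from ⟨2, by norm_num⟩).trans h4) hΔ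

/-- **`d ≡ 3 (mod 4)`, ordinary case: Kodaira type `I₄*` with `ord Δ = 12`.**  For
`V = ⟨1, a₂, 0, a₄, a₆⟩` with `4 ∣ a₄`, `Δ ∈ Rˣ` (so `a₆ ∈ Rˣ`) and `d = 4k + 3`, the model
`M = ⟨2, d(1 + 4a₂) - 1, 0, 16d²a₄, 64d³a₆⟩` (the twist `V^{(d)}` rescaled by `u = 1/2` and
translated by `s = 1/2`, see `smul_quadraticTwist_eq_modelThree`) has `a₁ = ϖε`,
`a₂ = ϖ·ε(2k + 1 + 2d a₂)` (`ϖ ∥ a₂`), `ϖ⁶ ∣ a₄`, `a₆ = ϖ⁶·(ε⁶d³a₆)`: family A of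
`TateAlgorithmIstarCharTwoProofs` with `N = 6`, so Tate's algorithm returns `I*₄`; and
`Δ(M) = 2¹² d⁶ Δ(V)` has `ord = 12`.  Barrios et al. 2025, Thm. 5.1, table `v(d) = 0`, row
`I₀`, `d ≡ 3 mod 4`, `v(a₁) = 0`: `I₄*`, `(δ, δ^d) = (0, 12)`; Silverman *ATAEC* IV.9.4.
[cite: BarriosEtAl2025, Thm. 5.1, §5 table v(d) = 0, row I₀ (arXiv p. 15)]
[cite: SilvermanATAEC1994, IV.9.4 Step 7 (PDF p. 346)] -/
theorem kodairaSymbolOfMinimal_twistGoodOrdinary_three {d k : ℤ} (hd : d = 4 * k + 3) :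
    (⟨2, (d : R) * (1 + 4 * V.a₂) - 1, 0, 16 * (d : R) ^ 2 * V.a₄, 64 * (d : R) ^ 3 * V.a₆⟩ :
        WeierstrassCurve R).kodairaSymbolOfMinimal = .Istar 4 ∧
      (addVal R (⟨2, (d : R) * (1 + 4 * V.a₂) - 1, 0, 16 * (d : R) ^ 2 * V.a₄,
        64 * (d : R) ^ 3 * V.a₆⟩ : WeierstrassCurve R).Δ).toNat = 12 ∧
      (⟨2, (d : R) * (1 + 4 * V.a₂) - 1, 0, 16 * (d : R) ^ 2 * V.a₄, 64 * (d : R) ^ 3 * V.a₆⟩ :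
        WeierstrassCurve R).Δ = 2 ^ 12 * (d : R) ^ 6 * V.Δ := by
  set ϖ := uniformizer R with hϖdef
  have hϖ : Irreducible ϖ := irreducible_uniformizer
  have h6 : IsUnit V.a₆ := isUnit_a₆_ordinaryNormalForm hε V h1 h3 h4 hΔ
  set M : WeierstrassCurve R := ⟨2, (d : R) * (1 + 4 * V.a₂) - 1, 0, 16 * (d : R) ^ 2 * V.a₄,
    64 * (d : R) ^ 3 * V.a₆⟩ with hM
  have hdu : IsUnit (d : R) := isUnit_intCast_of_odd hε ⟨2 * k + 1, by rw [hd]; ring⟩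
  have hMΔ : M.Δ = 2 ^ 12 * (d : R) ^ 6 * V.Δ := by
    simp only [hM, WeierstrassCurve.Δ, WeierstrassCurve.b₂, WeierstrassCurve.b₄,
      WeierstrassCurve.b₆, WeierstrassCurve.b₈, h1, h3]
    ring
  obtain ⟨q, hq⟩ := h4
  -- the coefficients in family-A shape
  have e1 : M.a₁ = ϖ * ε := hε
  set β : R := ε * ((2 * k + 1 : ℤ) + 2 * (d : R) * V.a₂) with hβ
  have e2 : M.a₂ = ϖ * β := by
    change (d : R) * (1 + 4 * V.a₂) - 1 = ϖ * β
    rw [hβ, hd]; push_cast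
    linear_combination (2 * k + 1 + 2 * (4 * (k : R) + 3) * V.a₂) * hε
  have hβu : IsUnit β := by
    refine hεu.mul ?_
    have : ((2 * k + 1 : ℤ) : R) + 2 * (d : R) * V.a₂ =
        ((2 * k + 1 : ℤ) : R) + ϖ * (ε * (d : R) * V.a₂) := by rw [hε]; ring
    rw [this]
    exact isUnit_add_mul_of_isUnit hϖ (isUnit_intCast_of_odd hε ⟨k, rfl⟩) _
  have e3 : M.a₃ = 0 := rfl
  have e4 : ϖ ^ 6 ∣ M.a₄ := by
    change ϖ ^ 6 ∣ 16 * (d : R) ^ 2 * V.a₄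
    rw [hq, show (16 : R) * (d : R) ^ 2 * (4 * q) = 2 ^ 6 * ((d : R) ^ 2 * q) by ring,
      two_pow_eq hε]
    exact (dvd_mul_right _ _).mul_right _
  set γ : R := ε ^ 6 * (d : R) ^ 3 * V.a₆ with hγ
  have e6 : M.a₆ = ϖ ^ 6 * γ := by
    change 64 * (d : R) ^ 3 * V.a₆ = ϖ ^ 6 * γ
    rw [hγ, show (64 : R) = 2 ^ 6 by norm_num, two_pow_eq hε]; ring
  have hγu : IsUnit γ := ((hεu.pow 6).mul (hdu.pow 3)).mul h6
  -- `ord Δ(M) = 12`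
  have hord : (addVal R M.Δ).toNat = 12 := by
    refine addVal_toNat_eq_of_eq hϖ isUnit_one ((hεu.pow 12).mul ((hdu.pow 6).mul hΔ)) ?_
    rw [one_mul, hMΔ, two_pow_eq hε]; ring
  refine ⟨?_, hord, hMΔ⟩
  have := kodairaSymbolOfMinimal_familyA (N := 6) (by norm_num) (by rw [hord]; norm_num) hε hεu
    e1 hεu e2 hβu e3 e4 e6 hγu
  simpa using this

/-- **`d ≡ 2 (mod 4)`, ordinary case: Kodaira type `I₈*` with `ord Δ = 18`.**  For
`V = ⟨1, a₂, 0, a₄, a₆⟩` with `4 ∣ a₄`, `Δ ∈ Rˣ` and `d = 4k + 2 = 2(2k + 1)`, the model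
`T = ⟨0, d(1 + 4a₂), 0, 16d²a₄, 64d³a₆⟩` (the twist rescaled by `u = 1/2`,
`smul_quadraticTwist_eq_modelTwo`) has `a₁ = 0`, `a₂ = ϖ·ε(2k + 1)(1 + 4a₂)`, `ϖ⁸ ∣ a₄`,
`a₆ = ϖ⁹·(ε⁹(2k + 1)³a₆)`: family B with `N = 9`, so Tate's algorithm returns `I*₈`; and
`ord Δ(T) = 18`.  Barrios et al. 2025, Thm. 5.1, table `v(d) = 1`, row `I₀`, `v(a₁) = 0`:
`I₈*`, `(δ, δ^d) = (0, 18)`; Silverman *ATAEC* IV.9.4.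
[cite: BarriosEtAl2025, Thm. 5.1, §5 table v(d) = 1, row I₀ (arXiv p. 16)]
[cite: SilvermanATAEC1994, IV.9.4 Step 7 (PDF p. 346)] -/
theorem kodairaSymbolOfMinimal_twistGoodOrdinary_two {d k : ℤ} (hd : d = 4 * k + 2) :
    (⟨0, (d : R) * (1 + 4 * V.a₂), 0, 16 * (d : R) ^ 2 * V.a₄, 64 * (d : R) ^ 3 * V.a₆⟩ :
        WeierstrassCurve R).kodairaSymbolOfMinimal = .Istar 8 ∧
      (addVal R (⟨0, (d : R) * (1 + 4 * V.a₂), 0, 16 * (d : R) ^ 2 * V.a₄,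
        64 * (d : R) ^ 3 * V.a₆⟩ : WeierstrassCurve R).Δ).toNat = 18 ∧
      (⟨0, (d : R) * (1 + 4 * V.a₂), 0, 16 * (d : R) ^ 2 * V.a₄, 64 * (d : R) ^ 3 * V.a₆⟩ :
        WeierstrassCurve R).Δ = 2 ^ 12 * (d : R) ^ 6 * V.Δ := by
  set ϖ := uniformizer R with hϖdef
  have hϖ : Irreducible ϖ := irreducible_uniformizer
  have h6 : IsUnit V.a₆ := isUnit_a₆_ordinaryNormalForm hε V h1 h3 h4 hΔ
  set T : WeierstrassCurve R := ⟨0, (d : R) * (1 + 4 * V.a₂), 0, 16 * (d : R) ^ 2 * V.a₄,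
    64 * (d : R) ^ 3 * V.a₆⟩ with hT
  set d₁ : ℤ := 2 * k + 1 with hd₁
  have hdd : (d : R) = 2 * (d₁ : R) := by rw [hd, hd₁]; push_cast; ring
  have hd₁u : IsUnit (d₁ : R) := isUnit_intCast_of_odd hε ⟨k, rfl⟩
  have hb₂u : IsUnit (1 + 4 * V.a₂ : R) := by
    have : (1 + 4 * V.a₂ : R) = 1 + ϖ * (ε * 2 * V.a₂) := by
      rw [show (4 : R) = 2 * 2 by norm_num, hε]; ring
    rw [this]; exact isUnit_one_add_uniformizer_mul _
  have hTΔ : T.Δ = 2 ^ 12 * (d : R) ^ 6 * V.Δ := by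
    simp only [hT, WeierstrassCurve.Δ, WeierstrassCurve.b₂, WeierstrassCurve.b₄,
      WeierstrassCurve.b₆, WeierstrassCurve.b₈, h1, h3]
    ring
  obtain ⟨q, hq⟩ := h4
  have e1 : T.a₁ = 0 := rfl
  set β : R := ε * (d₁ : R) * (1 + 4 * V.a₂) with hβ
  have e2 : T.a₂ = ϖ * β := by
    change (d : R) * (1 + 4 * V.a₂) = ϖ * β
    rw [hβ, hdd, hε]; ring
  have hβu : IsUnit β := (hεu.mul hd₁u).mul hb₂u
  have e3 : T.a₃ = 0 := rfl
  have e4 : ϖ ^ (9 - 1) ∣ T.a₄ := by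
    change ϖ ^ (9 - 1) ∣ 16 * (d : R) ^ 2 * V.a₄
    rw [hq, hdd, show (16 : R) * (2 * (d₁ : R)) ^ 2 * (4 * q) = 2 ^ 8 * ((d₁ : R) ^ 2 * q) by ring,
      two_pow_eq hε, show (9 - 1 : ℕ) = 8 by norm_num]
    exact (dvd_mul_right _ _).mul_right _
  set γ : R := ε ^ 9 * (d₁ : R) ^ 3 * V.a₆ with hγ
  have e6 : T.a₆ = ϖ ^ 9 * γ := by
    change 64 * (d : R) ^ 3 * V.a₆ = ϖ ^ 9 * γ
    rw [hγ, hdd, show (64 : R) * (2 * (d₁ : R)) ^ 3 * V.a₆ = 2 ^ 9 * ((d₁ : R) ^ 3 * V.a₆) by ring,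
      two_pow_eq hε]; ring
  have hγu : IsUnit γ := ((hεu.pow 9).mul (hd₁u.pow 3)).mul h6
  have hord : (addVal R T.Δ).toNat = 18 := by
    refine addVal_toNat_eq_of_eq hϖ isUnit_one ((hεu.pow 18).mul ((hd₁u.pow 6).mul hΔ)) ?_
    rw [one_mul, hTΔ, hdd, show (2 : R) ^ 12 * (2 * (d₁ : R)) ^ 6 * V.Δ =
      2 ^ 18 * ((d₁ : R) ^ 6 * V.Δ) by ring, two_pow_eq hε]; ring
  refine ⟨?_, hord, hTΔ⟩
  have := kodairaSymbolOfMinimal_familyB (N := 9) (by norm_num) (by rw [hord]; norm_num) hε hεu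
    e1 e2 hβu e3 e4 e6 hγu
  simpa using this

end Ordinary

end TwistGoodTwo

end Literature.NumberTheory.EllipticCurves
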